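import Summits.SmoothPoincare4.SmoothPoincare4.Theses.CongruenceShadows

/-!
# Sketch — crux-ideate stmt-SmoothPoincare4-14596 (HeegaardHandlebodyCongruenceClosed), ideator 1

First lemmas of the idea cards `fine-closure-collapse` and `orbit-closure-certificates`.
PROVED (no sorry): `crux_iff`, `levelCollapse` (the level form of the collapse lemma),
`crux_of_transfer` (FineApprox ∧ NoFineGhosts ∧ PairsStandard → crux), `normalForm`
(K_M-normal form), `crux_iff_certificates`.  STUBS (`sorry`, statements only):
`stub_profiniteCollapse`, `stub_cyclicCollapse`, `crux_iff_orbitClosed`.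
-/

set_option linter.dupNamespace false

noncomputable section

namespace Summit.SmoothPoincare4.SmoothPoincare4.Cruxes.HeegaardHandlebodyCongruenceClosed.Ideator1

open Literature.Topology.FourManifolds Subgroup
open Summit.SmoothPoincare4.SmoothPoincare4.Theses.CongruenceShadows (HeegaardHandlebodyCongruenceClosed)

/-- the surface group at the route's genus `g = 3 + 3m` -/
abbrev S (m : ℕ) : Type := SurfaceGroup (3 + 3 * m)

/-- the standard stabilised `S⁴` triple `N = (N₀, N₁, N₂)` -/
abbrev N (m : ℕ) : TrisectionKernels (3 + 3 * m) := s4Kernels.stabilizeIter m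

/-- `x ∈ P` : `x` preserves `N₀` and `N₁` (Heegaard / Goeritz group of the standard pair). -/
def InP (m : ℕ) (x : S m ≃* S m) : Prop :=
  (N m 0).map x.toMonoidHom = N m 0 ∧ (N m 1).map x.toMonoidHom = N m 1

/-- `c ∈ Q` : `c` preserves `N₂` (handlebody group). -/
def InQ (m : ℕ) (c : S m ≃* S m) : Prop := (N m 2).map c.toMonoidHom = N m 2

/-- `k ∈ K_M` : `k` acts trivially on `S / M`. -/
def InK (m : ℕ) (M : Subgroup (S m)) (k : S m ≃* S m) : Prop := ∀ s, k s * s⁻¹ ∈ M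

/-- hypothesis of the crux for one `ρ`: `ρ` lies in the (fine) congruence closure of `P · Q`. -/
def FineClosure (m : ℕ) (ρ : S m ≃* S m) : Prop :=
  ∀ M : Subgroup (S m), M.Characteristic → M.FiniteIndex →
    ∃ x c : S m ≃* S m, (N m 0).map x.toMonoidHom = N m 0 ∧ (N m 1).map x.toMonoidHom = N m 1 ∧
      (N m 2).map c.toMonoidHom = N m 2 ∧ ∀ s, ρ s * (x (c s))⁻¹ ∈ M

/-- conclusion of the crux for one `ρ`: `ρ ∈ P · Q`. -/
def InPQ (m : ℕ) (ρ : S m ≃* S m) : Prop :=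
  ∃ x c : S m ≃* S m, (N m 0).map x.toMonoidHom = N m 0 ∧ (N m 1).map x.toMonoidHom = N m 1 ∧
    (N m 2).map c.toMonoidHom = N m 2 ∧ ∀ s, ρ s = x (c s)

/-- the crux, read per `ρ` (definitional). -/
theorem crux_iff : HeegaardHandlebodyCongruenceClosed ↔ ∀ m ρ, FineClosure m ρ → InPQ m ρ :=
  Iff.rfl

/-- the twisted triple `T_ρ = (N₀, N₁, ρ N₂)` -/
def twisted (m : ℕ) (ρ : S m ≃* S m) : TrisectionKernels (3 + 3 * m) :=
  ![N m 0, N m 1, (N m 2).map ρ.toMonoidHom]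

/-- non-vacuity: the standard triple is a `(3+3m, m+1)` group trisection of `{1}` (two discharged
named facts of `GroupTrisections.lean`). -/
theorem stabilizeIter_isGroupTrisection (m : ℕ) :
    IsGroupTrisection (3 + 3 * m) (m + 1) (PUnit : Type) (N m) := by
  induction m with
  | zero => exact s4Kernels_isGroupTrisection_holds
  | succ m ih => exact stabilize_isGroupTrisection_holds _ _ _ _ ih

/-! ## Card `fine-closure-collapse` -/

/-- **Level collapse.** For every characteristic finite-index `M`, `M · ⟪N₀ ∪ N₁ ∪ ρN₂⟫ = S`:
the `x` supplied at level `M` preserves `M`, and `⟪N₀, N₁, k N₂⟫ · M = ⟪N₀, N₁, N₂⟫ · M = S`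
for `k ≡ id (mod M)`. -/
@[simp] theorem twisted_zero (m : ℕ) (ρ : S m ≃* S m) : twisted m ρ 0 = N m 0 := rfl
@[simp] theorem twisted_one (m : ℕ) (ρ : S m ≃* S m) : twisted m ρ 1 = N m 1 := rfl
@[simp] theorem twisted_two (m : ℕ) (ρ : S m ≃* S m) :
    twisted m ρ 2 = (N m 2).map ρ.toMonoidHom := rfl

/-- the standard triple normally generates `S`. -/
theorem normalClosure_N_eq_top (m : ℕ) :
    normalClosure (⋃ i, (N m i : Set (S m))) = ⊤ := by
  obtain ⟨e⟩ := (stabilizeIter_isGroupTrisection m).triple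
  haveI : Subsingleton (TrisectionKernels.tripleQuotient (N m)) := e.toEquiv.subsingleton
  exact QuotientGroup.subgroup_eq_top_of_subsingleton _ inferInstance

theorem le_normalClosure_twisted (m : ℕ) (ρ : S m ≃* S m) (i : Fin 3) :
    twisted m ρ i ≤ normalClosure (⋃ i, (twisted m ρ i : Set (S m))) := fun s hs =>
  subset_normalClosure (Set.mem_iUnion.2 ⟨i, hs⟩)

theorem levelCollapse (m : ℕ) (ρ : S m ≃* S m) (h : FineClosure m ρ)
    (M : Subgroup (S m)) (hM : M.Characteristic) (hF : M.FiniteIndex) :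
    M ⊔ normalClosure (⋃ i, (twisted m ρ i : Set (S m))) = ⊤ := by
  obtain ⟨x, c, hx0, hx1, hc2, hs⟩ := h M hM hF
  set R := normalClosure (⋃ i, (twisted m ρ i : Set (S m))) with hR
  haveI hRn : R.Normal := by rw [hR]; infer_instance
  haveI := hM
  haveI hMn : M.Normal := inferInstance
  haveI : (M ⊔ R).Normal := Subgroup.sup_normal M R
  -- every standard kernel lands in `M ⊔ R` after applying `x`
  have key0 : (N m 0).map x.toMonoidHom ≤ M ⊔ R := by
    rw [hx0]
    exact le_trans (le_of_eq (twisted_zero m ρ).symm)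
      (le_trans (le_normalClosure_twisted m ρ 0) le_sup_right)
  have key1 : (N m 1).map x.toMonoidHom ≤ M ⊔ R := by
    rw [hx1]
    exact le_trans (le_of_eq (twisted_one m ρ).symm)
      (le_trans (le_normalClosure_twisted m ρ 1) le_sup_right)
  have key2 : (N m 2).map x.toMonoidHom ≤ M ⊔ R := by
    rintro y ⟨n, hn, rfl⟩
    -- n ∈ N₂ = c(N₂): n = c n'
    have hn' : n ∈ (N m 2).map c.toMonoidHom := by rw [hc2]; exact hn
    obtain ⟨n', hn'2, rfl⟩ := hn'
    have hρ : ρ n' ∈ R :=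
      le_normalClosure_twisted m ρ 2 (by rw [twisted_two]; exact ⟨n', hn'2, rfl⟩)
    have hm : ρ n' * (x (c n'))⁻¹ ∈ M := hs n'
    have hxc : x (c n') = (ρ n' * (x (c n'))⁻¹)⁻¹ * ρ n' := by group
    show x.toMonoidHom (c.toMonoidHom n') ∈ M ⊔ R
    simp only [MulEquiv.coe_toMonoidHom]
    rw [hxc]
    exact mul_mem (mem_sup_left (inv_mem hm)) (mem_sup_right hρ)
  have key : ∀ i : Fin 3, (N m i).map x.toMonoidHom ≤ M ⊔ R := by
    intro i
    fin_cases i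
    · exact key0
    · exact key1
    · exact key2
  have htop : (⊤ : Subgroup (S m)) ≤ (M ⊔ R).comap x.toMonoidHom := by
    rw [← normalClosure_N_eq_top m]
    refine normalClosure_le_normal (Set.iUnion_subset fun i => ?_)
    intro s hs
    exact key i ⟨s, hs, rfl⟩
  refine eq_top_iff.2 fun t _ => ?_
  have := htop (Subgroup.mem_top (x.symm t))
  simpa using this

/-- **Collapse lemma (First lemma).** Under the fine-closure hypothesis every homomorphism to a
finite group killing `N₀`, `N₁` and `ρN₂` is trivial: `G_ρ = S/⟪N₀,N₁,ρN₂⟫` has trivial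
profinite completion (characteristic finite-index subgroups are cofinal in a f.g. group). -/
theorem stub_profiniteCollapse (m : ℕ) (ρ : S m ≃* S m) (h : FineClosure m ρ)
    (G : Type) [Group G] [Finite G] (f : S m →* G) (hf : ∀ i, twisted m ρ i ≤ f.ker) :
    ∀ s, f s = 1 := by
  sorry

/-- **Cyclic collapse at genus 3.** At `m = 0` the triple quotient of `T_ρ` is a quotient of
`S / N₀N₁ ≅ F₁ = ℤ`, hence cyclic; a cyclic group with no finite quotient is trivial. -/
theorem stub_cyclicCollapse (ρ : S 0 ≃* S 0) (h : FineClosure 0 ρ) :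
    normalClosure (⋃ i, (twisted 0 ρ i : Set (S 0))) = ⊤ := by
  sorry

/-- `FineApprox m`: a normalised `(3+3m, m+1)` group trisection of `{1}` in the fine closure is
standard (implied by the sibling crux `ShadowApproximation`, fine ⊆ coarse). -/
def FineApprox (m : ℕ) : Prop :=
  ∀ ρ : S m ≃* S m, FineClosure m ρ →
    IsGroupTrisection (3 + 3 * m) (m + 1) (PUnit : Type) (twisted m ρ) → InPQ m ρ

/-- `NoFineGhosts m`: in the fine closure the triple quotient is trivial (no Kervaire sphere on a
perfect group with trivial profinite completion enters the fine closure). Vacuous at `m = 0`. -/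
def NoFineGhosts (m : ℕ) : Prop :=
  ∀ ρ : S m ≃* S m, FineClosure m ρ → normalClosure (⋃ i, (twisted m ρ i : Set (S m))) = ⊤

/-- `PairsStandard m`: in the fine closure the pairs of `T_ρ` are genus-`g` splittings of
`#ᵏ(S¹ × S²)` (profinitely free by level collapse; then residual finiteness + Perelman +
Waldhausen, or Wilton–Zalesskii 2019), stated as the AGK freeness of the pair quotients. -/
def PairsStandard (m : ℕ) : Prop :=
  ∀ ρ : S m ≃* S m, FineClosure m ρ → ∀ i j : Fin 3, i ≠ j →
    IsFreeOfRank ((twisted m ρ).pairQuotient i j) (m + 1)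

/-- the transfer of card `fine-closure-collapse`: crux ⇐ FineApprox ∧ NoFineGhosts ∧ PairsStandard
(the remaining fields `normal`, `free_quotient` of `IsGroupTrisection (twisted m ρ)` are routine:
`ρN₂` is the image of a normal subgroup with free quotient under an automorphism). -/
theorem crux_of_transfer (hA : ∀ m, FineApprox m) (hG : ∀ m, NoFineGhosts m)
    (hP : ∀ m, PairsStandard m) : HeegaardHandlebodyCongruenceClosed := by
  rw [crux_iff]
  intro m ρ hρ
  have hN := stabilizeIter_isGroupTrisection m
  haveI hn2 : (N m 2).Normal := hN.normal 2
  haveI hn2' : ((N m 2).map ρ.toMonoidHom).Normal := Subgroup.Normal.map hn2 _ ρ.surjective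
  refine hA m ρ hρ ⟨?_, ?_, ?_, ?_⟩
  · intro i
    fin_cases i
    · exact hN.normal 0
    · exact hN.normal 1
    · exact hn2'
  · intro i
    fin_cases i
    · exact hN.free_quotient 0
    · exact hN.free_quotient 1
    · have h2 := hN.free_quotient 2
      change IsFreeOfRank (S m ⧸ normalClosure
        (((N m 2).map ρ.toMonoidHom : Subgroup (S m)) : Set (S m))) (3 + 3 * m)
      have e₁ : S m ⧸ normalClosure ((N m 2 : Subgroup (S m)) : Set (S m)) ≃* S m ⧸ N m 2 :=
        QuotientGroup.quotientMulEquivOfEq (normalClosure_eq_self _)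
      have e₂ : S m ⧸ N m 2 ≃* S m ⧸ (N m 2).map ρ.toMonoidHom :=
        QuotientGroup.congr (N m 2) ((N m 2).map ρ.toMonoidHom) ρ rfl
      have e₃ : S m ⧸ (N m 2).map ρ.toMonoidHom ≃*
          S m ⧸ normalClosure (((N m 2).map ρ.toMonoidHom : Subgroup (S m)) : Set (S m)) :=
        QuotientGroup.quotientMulEquivOfEq (normalClosure_eq_self _).symm
      exact ((h2.of_mulEquiv e₁).of_mulEquiv e₂).of_mulEquiv e₃
  · exact hP m ρ hρ
  · have htop := hG m ρ hρ
    haveI : Subsingleton ((twisted m ρ).tripleQuotient) := by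
      change Subsingleton (S m ⧸ normalClosure (⋃ i, (twisted m ρ i : Set (S m))))
      rw [htop]
      exact QuotientGroup.subsingleton_quotient_top
    letI : Unique ((twisted m ρ).tripleQuotient) := uniqueOfSubsingleton 1
    exact ⟨MulEquiv.ofUnique⟩

/-! ## Card `orbit-closure-certificates` -/

/-- **K_M-normal form.** In the fine closure, at each level `M` the triple `T_ρ` is `P`-equivalent
to `(N₀, N₁, k N₂)` with `k ≡ id (mod M)`. -/
theorem normalForm (m : ℕ) (ρ : S m ≃* S m) (h : FineClosure m ρ)
    (M : Subgroup (S m)) (hM : M.Characteristic) (hF : M.FiniteIndex) :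
    ∃ x k : S m ≃* S m, InP m x ∧ InK m M k ∧
      ((N m 2).map ρ.toMonoidHom).map x.symm.toMonoidHom = (N m 2).map k.toMonoidHom := by
  obtain ⟨x, c, hx0, hx1, hc2, hs⟩ := h M hM hF
  refine ⟨x, (c.symm.trans ρ).trans x.symm, ⟨hx0, hx1⟩, ?_, ?_⟩
  · intro s
    have h1 := hs (c.symm s)
    rw [MulEquiv.apply_symm_apply] at h1
    have hfix := hM.fixed x.symm
    rw [← hfix] at h1
    have h2 : x.symm (ρ (c.symm s) * (x s)⁻¹) ∈ M := Subgroup.mem_comap.1 h1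
    simpa [MulEquiv.trans_apply] using h2
  · have hcs : (N m 2).map c.symm.toMonoidHom = N m 2 := by
      conv_lhs => rw [← hc2]
      rw [Subgroup.map_map]
      have hid : c.symm.toMonoidHom.comp c.toMonoidHom = MonoidHom.id _ := by
        ext t
        simp
      rw [hid, Subgroup.map_id]
    have hk : ((c.symm.trans ρ).trans x.symm).toMonoidHom =
        x.symm.toMonoidHom.comp (ρ.toMonoidHom.comp c.symm.toMonoidHom) := by
      ext t
      rfl
    rw [hk, ← Subgroup.map_map, ← Subgroup.map_map, hcs]

/-- orbit-closure form: the `P`-orbit of `N₂` in the set of handlebody subgroups is closed for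
the topology with neighbourhood base `{K_M · N'}`. -/
def OrbitClosed (m : ℕ) : Prop :=
  ∀ N' : Subgroup (S m),
    (∀ M : Subgroup (S m), M.Characteristic → M.FiniteIndex →
      ∃ x k : S m ≃* S m, InP m x ∧ InK m M k ∧
        N'.map x.toMonoidHom = (N m 2).map k.toMonoidHom) →
    ∃ x : S m ≃* S m, InP m x ∧ N'.map x.toMonoidHom = N m 2

/-- crux ⟺ orbit closure (elementary; `K_M ◁ Aut S`). -/
theorem crux_iff_orbitClosed : HeegaardHandlebodyCongruenceClosed ↔ ∀ m, OrbitClosed m := by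
  sorry

/-- finite-level certificate that `ρ ∉ P · Q`. -/
def LevelCertified (m : ℕ) (ρ : S m ≃* S m) : Prop :=
  ∃ M : Subgroup (S m), M.Characteristic ∧ M.FiniteIndex ∧
    ∀ x c : S m ≃* S m, InP m x → InQ m c → ∃ s, ρ s * (x (c s))⁻¹ ∉ M

/-- **Certificate form (First lemma of card `orbit-closure-certificates`, proved).** The crux says
exactly: every `ρ` outside `P · Q` is certified at some characteristic finite level. -/
theorem crux_iff_certificates :
    HeegaardHandlebodyCongruenceClosed ↔ ∀ m ρ, ¬ InPQ m ρ → LevelCertified m ρ := by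
  rw [crux_iff]
  refine forall_congr' fun m => forall_congr' fun ρ => ?_
  constructor
  · intro h hn
    by_contra hc
    apply hn
    apply h
    intro M hM hF
    by_contra hx
    apply hc
    refine ⟨M, hM, hF, fun x c hx1 hc1 => ?_⟩
    by_contra hs
    push Not at hs
    exact hx ⟨x, c, hx1.1, hx1.2, hc1, hs⟩
  · intro h hfc
    by_contra hn
    obtain ⟨M, hM, hF, hc⟩ := h hn
    obtain ⟨x, c, h0, h1, h2, hs⟩ := hfc M hM hF
    obtain ⟨s, hs'⟩ := hc x c ⟨h0, h1⟩ h2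
    exact hs' (hs s)

end Summit.SmoothPoincare4.SmoothPoincare4.Cruxes.HeegaardHandlebodyCongruenceClosed.Ideator1
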